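import Summits.CriticalPhenomena.SAWScalingLimit.Theorems.SAWRenewalTightnessTubeLowerBoundReverseCutGlue
import Literature.Probability.RandomPlanarGeometry.SAWPatternTheorem

/-!
# Crux `TubeLowerBound` (stmt-CriticalPhenomena-4730), line `profile-potential`:
# by-product `cornerExitEast_mass_le_half`

`cornerExitEast_mass_le_half : ∀ R N, Θ_N(R) := Σ_{n ≤ N} e_n x_c^n ≤ 1/2`, where
`e_n = #cornerExitEast R n` counts the east first-exit prefixes of the closed square `[0,R]²` of a
corner-started self-avoiding walk of the quadrant `Q = {x ≥ 0, y ≥ 0}` of `ℤ²` (objects of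
`…TubeLowerBoundProfilePotentialDefs`).  This is the CEILING half of the sandwich whose floor half
`Θ_N(R) ≥ 1/(4A(R+2)^C)` the line `profile-potential` derives from its open stubs; it certifies the
landed `Negative.constraints` for this line.  PROVED outright (no named facts, no hypotheses).

Proof.  With `q_m = #quadWalks 0 m` and `Q_M := Σ_{m ≤ M} q_m x_c^m ≥ 1` (`one_le_quadMass`), the
reverse cut `2 Σ_{k ≤ n} e_k q_{n−k} ≤ q_n` (`cornerExitEast_reverseCut`,
`…TubeLowerBoundReverseCutGlue.lean`) summed over `n ≤ M` with weights `x_c^n` and restricted to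
`k ≤ N`, `n − k ≤ M − N` gives `2 Θ_N Q_{M−N} ≤ Q_M` for all `M ≥ N` (`weighted_cut`,
`abstract_key`).  Since `q_m ≤ c_m ≤ K ((1+η)μ)^m` for every `η > 0` (`Zd.count_le_mul_pow`, i.e.
`c_m^{1/m} → μ = 1/x_c`), `Q_M ≤ K (M+1) (1+η)^M` grows sub-exponentially (`quadMass_growth`), so
for every `ε > 0` some `M ≥ N` has `Q_M ≤ (1+ε) Q_{M−N}` — otherwise `Q_{jN} ≥ (1+ε)^j` for all
`j`, and with `(1+η)^N < 1+ε` an exponential would be dominated by a linear function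
(`Zd.eventually_linear_lt_pow`) (`exists_ratio_le`).  Hence `2 Θ_N ≤ 1 + ε` for every `ε > 0`
(`abstract_half`).

Sources: N. Madras, G. Slade, *The Self-Avoiding Walk* (Birkhäuser 1993), §1.2, (1.2.9)
(`c_n^{1/n} → μ`) and §1.5 / Lemma A.1 (generating-function form of cut inequalities);
J. M. Hammersley, D. J. A. Welsh, Quart. J. Math. Oxford (2) 13 (1962) 108–110.
-/

noncomputable section

namespace Summit.CriticalPhenomena.SAWScalingLimit.Theorems.TubeLowerBound.ProfilePotential

open scoped BigOperators Classical
open Filter Topology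
open Literature.Probability.LatticeModels
open Literature.Probability.RandomPlanarGeometry Literature.Probability.RandomPlanarGeometry.SAW

namespace CornerExitEastMassProof

/-- Nonnegativity of `q_m x_c^m`. -/
theorem term_nonneg (m : ℕ) : 0 ≤ ((quadWalks 0 m).card : ℝ) * criticalFugacity ^ m :=
  mul_nonneg (Nat.cast_nonneg _) (pow_nonneg criticalFugacity_pos.le _)

/-- The reverse cut with weights: `2 Σ_{k ≤ n} (e_k x_c^k) (q_{n−k} x_c^{n−k}) ≤ q_n x_c^n`. -/
theorem weighted_cut (R n : ℕ) :
    2 * ∑ k ∈ Finset.range (n + 1), ((cornerExitEast R k).card : ℝ) * criticalFugacity ^ k *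
        (((quadWalks 0 (n - k)).card : ℝ) * criticalFugacity ^ (n - k)) ≤
      ((quadWalks 0 n).card : ℝ) * criticalFugacity ^ n := by
  have hA : (2 : ℝ) * ∑ k ∈ Finset.range (n + 1),
      ((cornerExitEast R k).card : ℝ) * (quadWalks 0 (n - k)).card ≤ (quadWalks 0 n).card := by
    exact_mod_cast cornerExitEast_reverseCut R n
  have heq : 2 * ∑ k ∈ Finset.range (n + 1), ((cornerExitEast R k).card : ℝ) *
      criticalFugacity ^ k * (((quadWalks 0 (n - k)).card : ℝ) * criticalFugacity ^ (n - k)) =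
      (2 * ∑ k ∈ Finset.range (n + 1),
        ((cornerExitEast R k).card : ℝ) * (quadWalks 0 (n - k)).card) * criticalFugacity ^ n := by
    rw [mul_assoc, Finset.sum_mul]
    congr 1
    refine Finset.sum_congr rfl fun k hk => ?_
    rw [Finset.mem_range] at hk
    have : criticalFugacity ^ k * criticalFugacity ^ (n - k) = criticalFugacity ^ n := by
      rw [← pow_add, Nat.add_sub_cancel' (Nat.le_of_lt_succ hk)]
    rw [← this]
    ring
  rw [heq]
  exact mul_le_mul_of_nonneg_right hA (pow_nonneg criticalFugacity_pos.le n)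

/-- **Abstract key inequality.** If `E, G ≥ 0` satisfy `2 Σ_{k ≤ n} E_k G_{n−k} ≤ G_n` for all `n`,
then `2 (Σ_{k ≤ N} E_k) (Σ_{j ≤ M−N} G_j) ≤ Σ_{m ≤ M} G_m` for `M ≥ N` (restrict the double sum
`Σ_{n ≤ M} Σ_{k ≤ n}` to `k ≤ N`, `n − k ≤ M − N`). -/
theorem abstract_key (E G : ℕ → ℝ) (hE : ∀ k, 0 ≤ E k) (hG : ∀ m, 0 ≤ G m)
    (hcut : ∀ n, 2 * ∑ k ∈ Finset.range (n + 1), E k * G (n - k) ≤ G n) {N M : ℕ}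
    (hNM : N ≤ M) :
    2 * (∑ k ∈ Finset.range (N + 1), E k) * ∑ j ∈ Finset.range (M - N + 1), G j ≤
      ∑ m ∈ Finset.range (M + 1), G m := by
  -- adapted from `Negative.triangle_sum_le` (…/AnnularMassDecay/Negative/HalfPlaneDivergence.lean)
  have hswap : ∑ n ∈ Finset.range (M + 1), ∑ k ∈ Finset.range (n + 1), E k * G (n - k) =
      ∑ k ∈ Finset.range (M + 1), ∑ n ∈ Finset.Ico k (M + 1), E k * G (n - k) := by
    refine Finset.sum_comm' fun n k => ?_
    simp only [Finset.mem_range, Finset.mem_Ico]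
    omega
  have hlow : (∑ k ∈ Finset.range (N + 1), E k) * ∑ j ∈ Finset.range (M - N + 1), G j ≤
      ∑ n ∈ Finset.range (M + 1), ∑ k ∈ Finset.range (n + 1), E k * G (n - k) := by
    rw [hswap, Finset.sum_mul]
    calc ∑ k ∈ Finset.range (N + 1), E k * ∑ j ∈ Finset.range (M - N + 1), G j
        ≤ ∑ k ∈ Finset.range (N + 1), E k * ∑ j ∈ Finset.range (M + 1 - k), G j := by
          refine Finset.sum_le_sum fun k hk => mul_le_mul_of_nonneg_left ?_ (hE k)
          rw [Finset.mem_range] at hk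
          exact Finset.sum_le_sum_of_subset_of_nonneg (Finset.range_mono (by omega))
            fun j _ _ => hG j
      _ ≤ ∑ k ∈ Finset.range (M + 1), E k * ∑ j ∈ Finset.range (M + 1 - k), G j :=
          Finset.sum_le_sum_of_subset_of_nonneg (Finset.range_mono (by omega)) fun k _ _ =>
            mul_nonneg (hE k) (Finset.sum_nonneg fun j _ => hG j)
      _ = ∑ k ∈ Finset.range (M + 1), ∑ n ∈ Finset.Ico k (M + 1), E k * G (n - k) := by
          refine Finset.sum_congr rfl fun k _ => ?_
          rw [Finset.mul_sum, Finset.sum_Ico_eq_sum_range]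
          refine Finset.sum_congr rfl fun j _ => ?_
          rw [Nat.add_sub_cancel_left]
  have hup : 2 * ∑ n ∈ Finset.range (M + 1), ∑ k ∈ Finset.range (n + 1), E k * G (n - k) ≤
      ∑ m ∈ Finset.range (M + 1), G m := by
    rw [Finset.mul_sum]
    exact Finset.sum_le_sum fun n _ => hcut n
  calc 2 * (∑ k ∈ Finset.range (N + 1), E k) * ∑ j ∈ Finset.range (M - N + 1), G j
      = 2 * ((∑ k ∈ Finset.range (N + 1), E k) * ∑ j ∈ Finset.range (M - N + 1), G j) := by ring
    _ ≤ 2 * ∑ n ∈ Finset.range (M + 1), ∑ k ∈ Finset.range (n + 1), E k * G (n - k) :=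
        mul_le_mul_of_nonneg_left hlow (by norm_num)
    _ ≤ _ := hup

/-- **Sub-exponential sequences have ratio liminf `≤ 1` along any lag.** If `Q ≥ 1` and
`Q_M ≤ K_η (M+1) (1+η)^M` for every `η > 0`, then for every `N` and `ε > 0` some `M ≥ N` has
`Q_M ≤ (1+ε) Q_{M−N}` (otherwise `Q_{jN} ≥ (1+ε)^j`; choose `(1+η)^N < 1+ε`: exponential versus
linear growth, `Zd.eventually_linear_lt_pow`). -/
theorem exists_ratio_le (Q : ℕ → ℝ) (h1 : ∀ M, 1 ≤ Q M)
    (hgrowth : ∀ η : ℝ, 0 < η → ∃ K : ℝ, 0 < K ∧ ∀ M : ℕ, Q M ≤ K * ((M : ℝ) + 1) * (1 + η) ^ M)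
    (N : ℕ) {ε : ℝ} (hε : 0 < ε) : ∃ M : ℕ, N ≤ M ∧ Q M ≤ (1 + ε) * Q (M - N) := by
  by_contra! H
  -- exponential growth along the multiples of `N`
  have hgrow : ∀ j : ℕ, (1 + ε) ^ j ≤ Q (j * N) := by
    intro j
    induction j with
    | zero => simpa using h1 0
    | succ j ih =>
      have hstep := H ((j + 1) * N) (Nat.le_mul_of_pos_left N (Nat.succ_pos j))
      rw [show (j + 1) * N - N = j * N by rw [Nat.add_mul, one_mul, Nat.add_sub_cancel]] at hstep
      calc (1 + ε) ^ (j + 1) = (1 + ε) * (1 + ε) ^ j := pow_succ' _ _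
        _ ≤ (1 + ε) * Q (j * N) := mul_le_mul_of_nonneg_left ih (by linarith)
        _ ≤ Q ((j + 1) * N) := hstep.le
  -- a rate `η` with `(1+η)^N < 1+ε`
  obtain ⟨η, hη, hηN⟩ : ∃ η : ℝ, 0 < η ∧ (1 + η) ^ N < 1 + ε := by
    have hcont : ContinuousAt (fun η : ℝ => (1 + η) ^ N) 0 :=
      ((continuous_const.add continuous_id).pow N).continuousAt
    have hlt : (fun η : ℝ => (1 + η) ^ N) 0 < 1 + ε := by
      simp only [add_zero, one_pow]
      linarith
    obtain ⟨δ, hδ, hball⟩ :=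
      Metric.eventually_nhds_iff.1 (Filter.Tendsto.eventually hcont (gt_mem_nhds hlt))
    refine ⟨δ / 2, by linarith, hball ?_⟩
    rw [Real.dist_eq, sub_zero, abs_of_pos (by linarith)]
    linarith
  obtain ⟨K, hK, hKM⟩ := hgrowth η hη
  have hpos : 0 < (1 + η) ^ N := by positivity
  have hb1 : 1 < (1 + ε) / (1 + η) ^ N := (one_lt_div hpos).2 hηN
  have hbound : ∀ j : ℕ, ((1 + ε) / (1 + η) ^ N) ^ j ≤ K * N * j + K := by
    intro j
    have h := (hgrow j).trans (hKM (j * N))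
    rw [pow_mul'] at h
    rw [div_pow, div_le_iff₀ (pow_pos hpos j)]
    calc (1 + ε) ^ j ≤ K * (((j * N : ℕ) : ℝ) + 1) * ((1 + η) ^ N) ^ j := h
      _ = (K * N * j + K) * ((1 + η) ^ N) ^ j := by
          push_cast
          ring
  obtain ⟨j, hj⟩ := (Zd.eventually_linear_lt_pow hb1 (K * N) K).exists
  exact absurd (hbound j) (not_le.2 hj)

/-- **Abstract conclusion.** If `Q ≥ 1` grows sub-exponentially and `2 Θ Q_{M−N} ≤ Q_M` for all
`M ≥ N`, then `Θ ≤ 1/2`. -/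
theorem abstract_half {Θ : ℝ} (Q : ℕ → ℝ) (N : ℕ) (h1 : ∀ M, 1 ≤ Q M)
    (hgrowth : ∀ η : ℝ, 0 < η → ∃ K : ℝ, 0 < K ∧ ∀ M : ℕ, Q M ≤ K * ((M : ℝ) + 1) * (1 + η) ^ M)
    (hkey : ∀ M, N ≤ M → 2 * Θ * Q (M - N) ≤ Q M) : Θ ≤ 1 / 2 := by
  have h2 : 2 * Θ ≤ 1 := by
    refine le_of_forall_pos_le_add fun ε hε => ?_
    obtain ⟨M, hM, hQ⟩ := exists_ratio_le Q h1 hgrowth N hε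
    have hpos : 0 < Q (M - N) := by linarith [h1 (M - N)]
    exact le_of_mul_le_mul_right ((hkey M hM).trans hQ) hpos
  linarith

/-- `Q_M := Σ_{m ≤ M} q_m x_c^m ≥ q_0 = 1` (the zero-step walk). -/
theorem one_le_quadMass (M : ℕ) :
    1 ≤ ∑ m ∈ Finset.range (M + 1), ((quadWalks 0 m).card : ℝ) * criticalFugacity ^ m := by
  have h0 : (fun _ => (0 : Site 2)) ∈ quadWalks 0 0 := by
    rw [quadWalks, Finset.mem_filter]
    refine ⟨Zd.mem_saws.2 ⟨rfl, fun i _ => rfl, fun i hi => absurd hi (Nat.not_lt_zero i),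
      fun i hi j hj _ => ?_⟩, fun i _ => by simp⟩
    simp only [Set.mem_setOf_eq, Nat.le_zero] at hi hj
    rw [hi, hj]
  have h1 : (1 : ℝ) ≤ (quadWalks 0 0).card := by
    exact_mod_cast Finset.one_le_card.2 ⟨_, h0⟩
  calc (1 : ℝ) ≤ ((quadWalks 0 0).card : ℝ) * criticalFugacity ^ 0 := by
        rw [pow_zero, mul_one]
        exact h1
    _ ≤ _ :=
        Finset.single_le_sum (f := fun m => ((quadWalks 0 m).card : ℝ) * criticalFugacity ^ m)
          (fun m _ => term_nonneg m) (Finset.mem_range.2 (Nat.succ_pos M))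

/-- **Sub-exponential growth of `Q_M`**: `Q_M ≤ K (M+1) (1+η)^M`, from `q_m ≤ c_m ≤ K ((1+η)μ)^m`
(`Zd.count_le_mul_pow`) and `x_c = μ⁻¹`. -/
theorem quadMass_growth {η : ℝ} (hη : 0 < η) :
    ∃ K : ℝ, 0 < K ∧ ∀ M : ℕ, ∑ m ∈ Finset.range (M + 1), ((quadWalks 0 m).card : ℝ) *
      criticalFugacity ^ m ≤ K * ((M : ℝ) + 1) * (1 + η) ^ M := by
  obtain ⟨K, hK1, hK⟩ := Zd.count_le_mul_pow 2 hη
  have hμ : 0 < Zd.connectiveConstant 2 := Zd.connectiveConstant_pos 2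
  refine ⟨K, by linarith, fun M => ?_⟩
  have hterm : ∀ m ∈ Finset.range (M + 1),
      ((quadWalks 0 m).card : ℝ) * criticalFugacity ^ m ≤ K * (1 + η) ^ M := by
    intro m hm
    rw [Finset.mem_range] at hm
    have hq : ((quadWalks 0 m).card : ℝ) ≤ Zd.count 2 m := by
      rw [quadWalks, ← Zd.card_saws 2 m]
      exact_mod_cast Finset.card_filter_le _ _
    have hpow : ((1 + η) * Zd.connectiveConstant 2) ^ m * criticalFugacity ^ m = (1 + η) ^ m := by
      rw [show criticalFugacity = (Zd.connectiveConstant 2)⁻¹ from rfl, ← mul_pow, mul_assoc,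
        mul_inv_cancel₀ hμ.ne', mul_one]
    calc ((quadWalks 0 m).card : ℝ) * criticalFugacity ^ m
        ≤ K * ((1 + η) * Zd.connectiveConstant 2) ^ m * criticalFugacity ^ m :=
          mul_le_mul_of_nonneg_right (hq.trans (hK m)) (pow_nonneg criticalFugacity_pos.le m)
      _ = K * (1 + η) ^ m := by rw [mul_assoc, hpow]
      _ ≤ K * (1 + η) ^ M :=
          mul_le_mul_of_nonneg_left (pow_le_pow_right₀ (by linarith) (by omega)) (by linarith)
  calc ∑ m ∈ Finset.range (M + 1), ((quadWalks 0 m).card : ℝ) * criticalFugacity ^ m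
      ≤ ∑ _m ∈ Finset.range (M + 1), K * (1 + η) ^ M := Finset.sum_le_sum hterm
    _ = K * ((M : ℝ) + 1) * (1 + η) ^ M := by
        rw [Finset.sum_const, Finset.card_range, nsmul_eq_mul]
        push_cast
        ring

end CornerExitEastMassProof

open CornerExitEastMassProof in
/-- **`Θ_N(R) ≤ 1/2`** (registered by-product `cornerExitEast_mass_le_half` of the line
`profile-potential`): for all `R N`, `Σ_{n ≤ N} e_n x_c^n ≤ 1/2`, `e_n = #cornerExitEast R n` —
the critical mass of the east first-exit prefixes of the square `[0,R]²` is at most one half.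
Reverse cut (glue an east exit prefix, or its diagonal mirror image, to any corner walk:
`2 Σ_k e_k q_{n−k} ≤ q_n`), summed at `x_c` against the sub-exponentially growing partial sums
`Q_M = Σ_{m ≤ M} q_m x_c^m` (`c_m^{1/m} → μ`).  (Hammersley–Welsh 1962; Madras–Slade 1993 §1.2.) -/
theorem cornerExitEast_mass_le_half : ∀ R N : ℕ,
    ∑ n ∈ Finset.range (N + 1), ((cornerExitEast R n).card : ℝ) * criticalFugacity ^ n ≤ 1 / 2 := by
  intro R N
  refine abstract_half (fun M => ∑ m ∈ Finset.range (M + 1), ((quadWalks 0 m).card : ℝ) *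
    criticalFugacity ^ m) N one_le_quadMass (fun η hη => quadMass_growth hη) fun M hM => ?_
  exact abstract_key (fun k => ((cornerExitEast R k).card : ℝ) * criticalFugacity ^ k)
    (fun m => ((quadWalks 0 m).card : ℝ) * criticalFugacity ^ m)
    (fun k => mul_nonneg (Nat.cast_nonneg _) (pow_nonneg criticalFugacity_pos.le _))
    term_nonneg (weighted_cut R) hM

end Summit.CriticalPhenomena.SAWScalingLimit.Theorems.TubeLowerBound.ProfilePotential

end
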